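import Mathlib
import Literature.RepresentationTheory.FiniteGroups.KLRGradedCellularBasis

/-!
# The alternating corner charge of a Young diagram (closed form)

Line `klr-graded-polynomial-method` of crux `SnSubsetDichotomy.NoThresholdSubsetTriple`
(stmt-MatrixMultiplication-8302), registered infrastructure sub-goal `altCornerCharge_eq` of the
open stub `stub_degreeTailSingle`.

Cells are `(row, col) : ℕ × ℕ` (0-based, English convention), `μ` is a finite LOWER SET of cells
(a Young diagram), the content of a cell is `col − row` and its sign is `π = (-1)^{row+col}`;
addable / removable nodes are the tree's `addableNodes` / `removableNodes`
(`Literature/RepresentationTheory/FiniteGroups/KLRGradedCellularBasis.lean`). The alternating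
corner charge left of `u` is `M_μ(u) = Σ_{addable B, content B < u} π(B) − Σ_{removable B,
content B < u} π(B)`, and the theorem `altCornerCharge_eq` is the closed form
`M_μ(u) = [0 < u] − Σ_{x ∈ μ} κ(u − content x) π(x)`, `κ(d) = 4 (d ≥ 2), 3 (d = 1), 1 (d = 0),
0 (d < 0)` — the `p = 2` mechanism behind the Brundan–Kleshchev–Wang tableau degree.

Proof: induction on `#μ`, removing a cell of maximal `row + col`; the heart is the local update
`altCharge_insert` (adding an addable cell `x` moves the charge by `−π(x)` at the contents
`content x − 1`, `content x` (twice), `content x + 1`), computed from the explicit change of the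
corner sets (`addableNodes_insert`, `removableNodes_insert`) and the dichotomies
`left_mem_removableNodes_iff`, `up_mem_removableNodes_iff`.
-/

namespace Summit.MatrixMultiplication.MatrixMultiplication.Theorems

open Literature.RepresentationTheory.FiniteGroups

set_option linter.dupNamespace false in -- deliberate Summit.<S>.<P> duplicate
/-- Removable nodes after adding an addable cell `(r, c)` to `ν`: the new cell becomes removable,
and its left neighbour `(r, c-1)` and upper neighbour `(r-1, c)` stop being removable (if they
were); nothing else changes. [folklore] -/
theorem removableNodes_insert {ν : Finset (ℕ × ℕ)} {r c : ℕ} (hp : (r + 1, c) ∉ ν)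
    (hq : (r, c + 1) ∉ ν) (hxν : (r, c) ∉ ν) :
    removableNodes (insert (r, c) ν) =
      insert (r, c) (((removableNodes ν).erase (r, c - 1)).erase (r - 1, c)) := by
  ext ⟨a, b⟩
  simp only [mem_removableNodes, IsRemovableNode, Finset.mem_insert, Finset.mem_erase,
    Prod.mk.injEq, ne_eq]
  constructor
  · rintro ⟨h0, h1, h2⟩
    rcases h0 with h0 | h0
    · exact Or.inl h0
    · refine Or.inr ⟨?_, ?_, h0, fun h => h1 (Or.inr h), fun h => h2 (Or.inr h)⟩
      · rintro ⟨rfl, rfl⟩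
        rcases Nat.eq_zero_or_pos r with rfl | hr
        · exact hxν (by simpa using h0)
        · exact h1 (Or.inl ⟨by omega, rfl⟩)
      · rintro ⟨rfl, rfl⟩
        rcases Nat.eq_zero_or_pos c with rfl | hc
        · exact hxν (by simpa using h0)
        · exact h2 (Or.inl ⟨rfl, by omega⟩)
  · rintro (⟨rfl, rfl⟩ | ⟨hb, ha, h0, h1, h2⟩)
    · exact ⟨Or.inl ⟨rfl, rfl⟩, fun h => h.elim (fun h => absurd h.1 (by omega)) hp,
        fun h => h.elim (fun h => absurd h.2 (by omega)) hq⟩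
    · refine ⟨Or.inr h0, ?_, ?_⟩
      · rintro (⟨h, rfl⟩ | h)
        · exact hb ⟨by omega, rfl⟩
        · exact h1 h
      · rintro (⟨rfl, h⟩ | h)
        · exact ha ⟨rfl, by omega⟩
        · exact h2 h

set_option linter.dupNamespace false in -- deliberate Summit.<S>.<P> duplicate
/-- Addable nodes after adding an addable cell `(r, c)` to `ν`: the new cell stops being addable,
and the only possible new addable nodes are `(r+1, c)` and `(r, c+1)`. [folklore] -/
theorem addableNodes_insert {ν : Finset (ℕ × ℕ)} {r c : ℕ} (hxν : (r, c) ∉ ν)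
    (hup : r = 0 ∨ (r - 1, c) ∈ ν) (hleft : c = 0 ∨ (r, c - 1) ∈ ν) :
    ((insert (r, c) (addableNodes (insert (r, c) ν))).erase (r + 1, c)).erase (r, c + 1) =
      addableNodes ν := by
  ext ⟨a, b⟩
  simp only [Finset.mem_erase, Finset.mem_insert, mem_addableNodes, IsAddableNode, Prod.mk.injEq,
    ne_eq, not_or]
  constructor
  · rintro ⟨hq', hp', h | ⟨⟨-, hmem⟩, hu, hl⟩⟩
    · obtain ⟨rfl, rfl⟩ := h
      exact ⟨hxν, hup, hleft⟩
    · refine ⟨hmem, ?_, ?_⟩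
      · rcases hu with h | ⟨h, rfl⟩ | h
        · exact Or.inl h
        · refine Or.inl ?_
          by_contra h'
          exact hp' ⟨by omega, rfl⟩
        · exact Or.inr h
      · rcases hl with h | ⟨rfl, h⟩ | h
        · exact Or.inl h
        · refine Or.inl ?_
          by_contra h'
          exact hq' ⟨rfl, by omega⟩
        · exact Or.inr h
  · rintro ⟨hmem, hu, hl⟩
    refine ⟨?_, ?_, ?_⟩
    · rintro ⟨rfl, rfl⟩
      rcases hl with h | h
      · omega
      · exact hxν (by simpa using h)
    · rintro ⟨rfl, rfl⟩
      rcases hu with h | h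
      · omega
      · exact hxν (by simpa using h)
    · by_cases hab : a = r ∧ b = c
      · exact Or.inl hab
      · exact Or.inr ⟨⟨hab, hmem⟩, hu.imp_right Or.inr, hl.imp_right Or.inr⟩

set_option linter.dupNamespace false in -- deliberate Summit.<S>.<P> duplicate
/-- After adding the addable cell `(r, c)` to `ν`, the cell `(r+1, c)` below it is addable iff the
left neighbour `(r, c-1)` was NOT a removable node of `ν` (the dichotomy at content
`c - r - 1`). [folklore] -/
theorem left_mem_removableNodes_iff {ν : Finset (ℕ × ℕ)} {r c : ℕ} (hxν : (r, c) ∉ ν)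
    (hleft : c = 0 ∨ (r, c - 1) ∈ ν) (hp : (r + 1, c) ∉ ν) :
    (r, c - 1) ∈ removableNodes ν ↔ ¬IsAddableNode (insert (r, c) ν) (r + 1, c) := by
  have hA : IsAddableNode (insert (r, c) ν) (r + 1, c) ↔ (c = 0 ∨ (r + 1, c - 1) ∈ ν) := by
    refine ⟨fun h => ?_, fun h => ⟨?_, Or.inr ?_, ?_⟩⟩
    · rcases h.2.2 with h' | h'
      · exact Or.inl h'
      · rcases Finset.mem_insert.1 h' with h'' | h''
        · simp at h''
        · exact Or.inr h''
    · rw [Finset.mem_insert, not_or]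
      exact ⟨fun h => by simp at h, hp⟩
    · simp
    · exact h.imp id fun h' => Finset.mem_insert_of_mem h'
  rw [hA, mem_removableNodes, IsRemovableNode]
  dsimp only
  rcases Nat.eq_zero_or_pos c with rfl | hc
  · simp only [Nat.zero_sub, true_or, not_true_eq_false, iff_false, not_and]
    exact fun h => absurd h hxν
  · have h1 : (r, c - 1) ∈ ν := hleft.resolve_left (by omega)
    have h2 : c - 1 + 1 = c := by omega
    simp only [h1, h2, hxν, true_and, not_false_eq_true, and_true, not_or]
    exact ⟨fun h => ⟨by omega, h⟩, fun h => h.2⟩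

set_option linter.dupNamespace false in -- deliberate Summit.<S>.<P> duplicate
/-- After adding the addable cell `(r, c)` to `ν`, the cell `(r, c+1)` right of it is addable iff
the upper neighbour `(r-1, c)` was NOT a removable node of `ν` (the dichotomy at content
`c - r + 1`). [folklore] -/
theorem up_mem_removableNodes_iff {ν : Finset (ℕ × ℕ)} {r c : ℕ} (hxν : (r, c) ∉ ν)
    (hup : r = 0 ∨ (r - 1, c) ∈ ν) (hq : (r, c + 1) ∉ ν) :
    (r - 1, c) ∈ removableNodes ν ↔ ¬IsAddableNode (insert (r, c) ν) (r, c + 1) := by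
  have hA : IsAddableNode (insert (r, c) ν) (r, c + 1) ↔ (r = 0 ∨ (r - 1, c + 1) ∈ ν) := by
    refine ⟨fun h => ?_, fun h => ⟨?_, ?_, Or.inr ?_⟩⟩
    · rcases h.2.1 with h' | h'
      · exact Or.inl h'
      · rcases Finset.mem_insert.1 h' with h'' | h''
        · simp at h''
        · exact Or.inr h''
    · rw [Finset.mem_insert, not_or]
      exact ⟨fun h => by simp at h, hq⟩
    · exact h.imp id fun h' => Finset.mem_insert_of_mem h'
    · simp
  rw [hA, mem_removableNodes, IsRemovableNode]
  dsimp only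
  rcases Nat.eq_zero_or_pos r with rfl | hr
  · simp only [Nat.zero_sub, true_or, not_true_eq_false, iff_false, not_and]
    exact fun h => absurd h hxν
  · have h1 : (r - 1, c) ∈ ν := hup.resolve_left (by omega)
    have h2 : r - 1 + 1 = r := by omega
    simp only [h1, h2, hxν, true_and, not_false_eq_true, not_or]
    exact ⟨fun h => ⟨by omega, h⟩, fun h => h.2⟩

/-- Peeling one point off a finite sum, with a prescribed form of the membership test and of the
value. [folklore] -/
private theorem sum_eq_sum_erase_add_ite {α : Type*} [DecidableEq α] (s : Finset α) (a : α)
    (f : α → ℤ) (P : Prop) [Decidable P] (v : ℤ) (h : a ∈ s ↔ P)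
    (hv : a ∈ s → f a = v) : s.sum f = (s.erase a).sum f + if P then v else 0 := by
  by_cases ha : a ∈ s
  · rw [if_pos (h.1 ha), ← hv ha, Finset.sum_erase_add _ _ ha]
  · rw [if_neg fun hP => ha (h.2 hP), Finset.erase_eq_of_notMem ha, add_zero]

/-- `(-1)^m = -(-1)^n` when `m ≡ n + 1 (mod 2)`. [folklore] -/
private theorem neg_one_pow_eq_neg_of_mod_two {m n : ℕ} (h : m % 2 = (n + 1) % 2) :
    (-1 : ℤ) ^ m = -(-1 : ℤ) ^ n := by
  rw [neg_one_pow_eq_pow_mod_two, h, ← neg_one_pow_eq_pow_mod_two, pow_succ, mul_neg_one]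

set_option linter.dupNamespace false in -- deliberate Summit.<S>.<P> duplicate
/-- The signed, `F`-filtered sum over the addable nodes after adding the addable cell `(r, c)` to
`ν`: the node `(r, c)` is lost, and `(r+1, c)`, `(r, c+1)` (of sign `-(-1)^{r+c}`) are gained
when addable. [folklore] -/
theorem sum_addableNodes_insert {ν : Finset (ℕ × ℕ)} {r c : ℕ} (hxν : (r, c) ∉ ν)
    (hup : r = 0 ∨ (r - 1, c) ∈ ν) (hleft : c = 0 ∨ (r, c - 1) ∈ ν) (F : ℕ × ℕ → Prop)
    [DecidablePred F] :
    ((addableNodes (insert (r, c) ν)).filter F).sum (fun B => (-1 : ℤ) ^ (B.1 + B.2)) =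
      ((addableNodes ν).filter F).sum (fun B => (-1 : ℤ) ^ (B.1 + B.2))
        - (if F (r, c) then (-1 : ℤ) ^ (r + c) else 0)
        - (if IsAddableNode (insert (r, c) ν) (r + 1, c) ∧ F (r + 1, c) then (-1 : ℤ) ^ (r + c)
            else 0)
        - (if IsAddableNode (insert (r, c) ν) (r, c + 1) ∧ F (r, c + 1) then (-1 : ℤ) ^ (r + c)
            else 0) := by
  have hxA' : (r, c) ∉ addableNodes (insert (r, c) ν) := fun h =>
    (mem_addableNodes.1 h).1 (Finset.mem_insert_self _ _)
  have e3 := sum_eq_sum_erase_add_ite ((insert (r, c) (addableNodes (insert (r, c) ν))).filter F)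
    (r, c) (fun B => (-1 : ℤ) ^ (B.1 + B.2)) (F (r, c)) ((-1 : ℤ) ^ (r + c))
    (by simp [Finset.mem_filter]) (fun _ => rfl)
  rw [← Finset.filter_erase, Finset.erase_insert hxA'] at e3
  have e1 := sum_eq_sum_erase_add_ite ((insert (r, c) (addableNodes (insert (r, c) ν))).filter F)
    (r + 1, c) (fun B => (-1 : ℤ) ^ (B.1 + B.2))
    (IsAddableNode (insert (r, c) ν) (r + 1, c) ∧ F (r + 1, c)) (-(-1 : ℤ) ^ (r + c))
    (by
      rw [Finset.mem_filter, Finset.mem_insert, mem_addableNodes]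
      exact ⟨fun h => ⟨h.1.resolve_left (by simp), h.2⟩, fun h => ⟨Or.inr h.1, h.2⟩⟩)
    (fun _ => neg_one_pow_eq_neg_of_mod_two (by dsimp only; omega))
  have e2 := sum_eq_sum_erase_add_ite
    (((insert (r, c) (addableNodes (insert (r, c) ν))).filter F).erase (r + 1, c))
    (r, c + 1) (fun B => (-1 : ℤ) ^ (B.1 + B.2))
    (IsAddableNode (insert (r, c) ν) (r, c + 1) ∧ F (r, c + 1)) (-(-1 : ℤ) ^ (r + c))
    (by
      rw [Finset.mem_erase, Finset.mem_filter, Finset.mem_insert, mem_addableNodes]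
      exact ⟨fun h => ⟨h.2.1.resolve_left (by simp), h.2.2⟩,
        fun h => ⟨by simp, Or.inr h.1, h.2⟩⟩)
    (fun _ => neg_one_pow_eq_neg_of_mod_two (by dsimp only; omega))
  have e5 : ((((insert (r, c) (addableNodes (insert (r, c) ν))).filter F).erase (r + 1, c)).erase
      (r, c + 1)) = (addableNodes ν).filter F := by
    rw [← Finset.filter_erase, ← Finset.filter_erase, addableNodes_insert hxν hup hleft]
  rw [e5] at e2
  rw [e1, e2] at e3
  split_ifs at e3 ⊢ <;> linarith

set_option linter.dupNamespace false in -- deliberate Summit.<S>.<P> duplicate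
/-- The signed, `F`-filtered sum over the removable nodes after adding the addable cell `(r, c)`
to `ν`: the node `(r, c)` is gained, and `(r, c-1)`, `(r-1, c)` (of sign `-(-1)^{r+c}`) are lost
when they were removable. [folklore] -/
theorem sum_removableNodes_insert {ν : Finset (ℕ × ℕ)} {r c : ℕ} (hp : (r + 1, c) ∉ ν)
    (hq : (r, c + 1) ∉ ν) (hxν : (r, c) ∉ ν) (F : ℕ × ℕ → Prop) [DecidablePred F] :
    ((removableNodes (insert (r, c) ν)).filter F).sum (fun B => (-1 : ℤ) ^ (B.1 + B.2)) =
      ((removableNodes ν).filter F).sum (fun B => (-1 : ℤ) ^ (B.1 + B.2))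
        + (if F (r, c) then (-1 : ℤ) ^ (r + c) else 0)
        + (if (r, c - 1) ∈ removableNodes ν ∧ F (r, c - 1) then (-1 : ℤ) ^ (r + c) else 0)
        + (if (r - 1, c) ∈ removableNodes ν ∧ F (r - 1, c) then (-1 : ℤ) ^ (r + c) else 0) := by
  have SR := removableNodes_insert hp hq hxν
  have hxR : (r, c) ∉ removableNodes ν := fun h => hxν (mem_removableNodes.1 h).1
  have hc : (r, c - 1) ∈ removableNodes ν → c ≠ 0 := by
    rintro h rfl
    exact hxR (by simpa using h)
  have hr : (r - 1, c) ∈ removableNodes ν → r ≠ 0 := by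
    rintro h rfl
    exact hxR (by simpa using h)
  have f3 := sum_eq_sum_erase_add_ite ((removableNodes (insert (r, c) ν)).filter F) (r, c)
    (fun B => (-1 : ℤ) ^ (B.1 + B.2)) (F (r, c)) ((-1 : ℤ) ^ (r + c))
    (by simp [Finset.mem_filter, SR]) (fun _ => rfl)
  rw [SR, ← Finset.filter_erase, Finset.erase_insert (fun h => hxR (Finset.mem_of_mem_erase
    (Finset.mem_of_mem_erase h))), Finset.filter_erase, Finset.filter_erase] at f3
  have f1 := sum_eq_sum_erase_add_ite ((removableNodes ν).filter F) (r, c - 1)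
    (fun B => (-1 : ℤ) ^ (B.1 + B.2)) ((r, c - 1) ∈ removableNodes ν ∧ F (r, c - 1))
    (-(-1 : ℤ) ^ (r + c)) (by rw [Finset.mem_filter])
    (fun h => neg_one_pow_eq_neg_of_mod_two (by
      have := hc (Finset.mem_filter.1 h).1
      dsimp only; omega))
  have f2 := sum_eq_sum_erase_add_ite (((removableNodes ν).filter F).erase (r, c - 1)) (r - 1, c)
    (fun B => (-1 : ℤ) ^ (B.1 + B.2)) ((r - 1, c) ∈ removableNodes ν ∧ F (r - 1, c))
    (-(-1 : ℤ) ^ (r + c))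
    (by
      rw [Finset.mem_erase, Finset.mem_filter, and_iff_right_iff_imp]
      rintro ⟨h, -⟩ h'
      have := hr h
      simp only [Prod.mk.injEq] at h'
      omega)
    (fun h => neg_one_pow_eq_neg_of_mod_two (by
      have := hr (Finset.mem_filter.1 (Finset.mem_of_mem_erase h)).1
      dsimp only; omega))
  rw [← SR] at f3
  rw [f3, f1, f2]
  split_ifs <;> linarith

/-- `κ(u − k) = 2·[k < u] + [k − 1 < u] + [k + 1 < u]` (`k = c − r`), as weights of the sign
`(-1)^{r+c}`. [folklore] -/
private theorem weight_eq (u : ℤ) (r c : ℕ) :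
    (if 2 ≤ u - ((c : ℤ) - r) then 4 else if u - ((c : ℤ) - r) = 1 then 3
        else if u - ((c : ℤ) - r) = 0 then 1 else 0) * (-1 : ℤ) ^ (r + c) =
      (2 * (if (c : ℤ) - r < u then 1 else 0) + (if (c : ℤ) - r - 1 < u then 1 else 0)
        + (if (c : ℤ) - r + 1 < u then 1 else 0)) * (-1 : ℤ) ^ (r + c) := by
  congr 1
  split_ifs <;> omega

set_option linter.dupNamespace false in -- deliberate Summit.<S>.<P> duplicate
/-- **Local update of the alternating corner charge.** Adding an addable cell `x` to a lower set
`ν` changes the charge left of `u`,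
`Σ_{addable B, content B < u} (-1)^{row+col} − Σ_{removable B, content B < u} (-1)^{row+col}`, by
`−κ(u − content x) · (-1)^{row x + col x}` (`κ(d) = 4, 3, 1, 0` for `d ≥ 2`, `d = 1`, `d = 0`,
`d < 0`): the charge moves by `−(-1)^{row x + col x}` at each of the contents `content x − 1`,
`content x` (twice), `content x + 1` lying left of `u`. [folklore] -/
theorem altCharge_insert {ν : Finset (ℕ × ℕ)} (hν : ∀ x ∈ ν, ∀ y : ℕ × ℕ, y ≤ x → y ∈ ν)
    {x : ℕ × ℕ} (hx : IsAddableNode ν x) (u : ℤ) :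
    ((addableNodes (insert x ν)).filter (fun B => (B.2 : ℤ) - B.1 < u)).sum
          (fun B => (-1 : ℤ) ^ (B.1 + B.2))
        - ((removableNodes (insert x ν)).filter (fun B => (B.2 : ℤ) - B.1 < u)).sum
          (fun B => (-1 : ℤ) ^ (B.1 + B.2)) =
      ((addableNodes ν).filter (fun B => (B.2 : ℤ) - B.1 < u)).sum
          (fun B => (-1 : ℤ) ^ (B.1 + B.2))
        - ((removableNodes ν).filter (fun B => (B.2 : ℤ) - B.1 < u)).sum
          (fun B => (-1 : ℤ) ^ (B.1 + B.2))
        - (if 2 ≤ u - ((x.2 : ℤ) - x.1) then 4 else if u - ((x.2 : ℤ) - x.1) = 1 then 3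
            else if u - ((x.2 : ℤ) - x.1) = 0 then 1 else 0) * (-1 : ℤ) ^ (x.1 + x.2) := by
  obtain ⟨r, c⟩ := x
  obtain ⟨hxν, hup, hleft⟩ := hx
  dsimp only at hup hleft ⊢
  have hp : (r + 1, c) ∉ ν := fun h => hxν (hν _ h _ ⟨by omega, le_rfl⟩)
  have hq : (r, c + 1) ∉ ν := fun h => hxν (hν _ h _ ⟨le_rfl, by omega⟩)
  have hA := sum_addableNodes_insert hxν hup hleft (fun B => (B.2 : ℤ) - B.1 < u)
  have hR := sum_removableNodes_insert hp hq hxν (fun B => (B.2 : ℤ) - B.1 < u)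
  have DP := left_mem_removableNodes_iff hxν hleft hp
  have DQ := up_mem_removableNodes_iff hxν hup hq
  have hc : ¬IsAddableNode (insert (r, c) ν) (r + 1, c) → c ≠ 0 := by
    rintro h rfl
    exact h ⟨by simpa using hp, Or.inr (by simp), Or.inl rfl⟩
  have hr : ¬IsAddableNode (insert (r, c) ν) (r, c + 1) → r ≠ 0 := by
    rintro h rfl
    exact h ⟨by simpa using hq, Or.inl rfl, Or.inr (by simp)⟩
  rw [hA, hR, weight_eq]
  simp only [DP, DQ]
  by_cases hP : IsAddableNode (insert (r, c) ν) (r + 1, c) <;>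
  by_cases hQ : IsAddableNode (insert (r, c) ν) (r, c + 1) <;>
  simp only [hP, hQ, not_true_eq_false, not_false_eq_true, true_and, false_and, if_false,
    true_implies, false_implies] at hc hr ⊢ <;>
  split_ifs <;> omega

/-- The empty diagram has the single addable node `(0, 0)`. [folklore] -/
private theorem addableNodes_empty : addableNodes (∅ : Finset (ℕ × ℕ)) = {(0, 0)} := by
  ext ⟨a, b⟩
  simp [mem_addableNodes, IsAddableNode, Prod.mk.injEq]

/-- The empty diagram has no removable node. [folklore] -/
private theorem removableNodes_empty : removableNodes (∅ : Finset (ℕ × ℕ)) = ∅ := by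
  ext x
  simp [mem_removableNodes, IsRemovableNode]

set_option linter.dupNamespace false in -- deliberate Summit.<S>.<P> duplicate
/-- **Closed form of the alternating corner charge** of a finite lower set of cells `μ` (a Young
diagram) with `n` cells: `M_μ(u) = [0 < u] − Σ_{x ∈ μ} κ(u − content x) · (-1)^{row x + col x}`.
By induction on `n`, removing a cell of maximal `row + col` (a removable node, addable to the
rest, which is again a lower set) and applying `altCharge_insert`. [folklore] -/
theorem altCharge_eq_of_card : ∀ (n : ℕ) (μ : Finset (ℕ × ℕ)), μ.card = n →
    (∀ x ∈ μ, ∀ y : ℕ × ℕ, y ≤ x → y ∈ μ) → ∀ u : ℤ,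
      ((addableNodes μ).filter (fun B => (B.2 : ℤ) - B.1 < u)).sum
            (fun B => (-1 : ℤ) ^ (B.1 + B.2))
          - ((removableNodes μ).filter (fun B => (B.2 : ℤ) - B.1 < u)).sum
            (fun B => (-1 : ℤ) ^ (B.1 + B.2)) =
        (if 0 < u then 1 else 0) - μ.sum (fun x => (if 2 ≤ u - ((x.2 : ℤ) - x.1) then 4
          else if u - ((x.2 : ℤ) - x.1) = 1 then 3 else if u - ((x.2 : ℤ) - x.1) = 0 then 1
          else 0) * (-1 : ℤ) ^ (x.1 + x.2)) := by
  intro n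
  induction n with
  | zero =>
    intro μ hcard _ u
    rw [Finset.card_eq_zero] at hcard
    subst hcard
    rw [addableNodes_empty, removableNodes_empty, Finset.filter_singleton]
    simp only [Nat.cast_zero, sub_zero, Finset.filter_empty, Finset.sum_empty]
    split_ifs <;> simp
  | succ n ih =>
    intro μ hcard hμ u
    have hne : μ.Nonempty := Finset.card_pos.1 (by omega)
    obtain ⟨x, hxμ, hmax⟩ := Finset.exists_max_image μ (fun y => y.1 + y.2) hne
    have hxν : x ∉ μ.erase x := Finset.notMem_erase x μ
    have hνl : ∀ z ∈ μ.erase x, ∀ y : ℕ × ℕ, y ≤ z → y ∈ μ.erase x := by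
      intro z hz y hyz
      obtain ⟨hzx, hzμ⟩ := Finset.mem_erase.1 hz
      refine Finset.mem_erase.2 ⟨?_, hμ z hzμ y hyz⟩
      rintro rfl
      have h1 := hmax z hzμ
      have h2 := Prod.le_def.1 hyz
      exact hzx (Prod.ext (by omega) (by omega))
    have hxadd : IsAddableNode (μ.erase x) x := by
      refine ⟨hxν, ?_, ?_⟩
      · rcases Nat.eq_zero_or_pos x.1 with h | h
        · exact Or.inl h
        · refine Or.inr (Finset.mem_erase.2 ⟨fun h' => ?_, hμ x hxμ _ ⟨by simp, le_rfl⟩⟩)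
          have := congrArg Prod.fst h'
          simp only at this
          omega
      · rcases Nat.eq_zero_or_pos x.2 with h | h
        · exact Or.inl h
        · refine Or.inr (Finset.mem_erase.2 ⟨fun h' => ?_, hμ x hxμ _ ⟨le_rfl, by simp⟩⟩)
          have := congrArg Prod.snd h'
          simp only at this
          omega
    have hcardν : (μ.erase x).card = n := by
      rw [Finset.card_erase_of_mem hxμ, hcard]
      rfl
    have key := altCharge_insert hνl hxadd u
    rw [Finset.insert_erase hxμ] at key
    rw [key, ih _ hcardν hνl u, ← Finset.add_sum_erase μ _ hxμ]
    ring

set_option linter.dupNamespace false in -- deliberate Summit.<S>.<P> duplicate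
/-- **Stub `altCornerCharge_eq` (line `klr-graded-polynomial-method`, crux
`SnSubsetDichotomy.NoThresholdSubsetTriple`, stmt-MatrixMultiplication-8302).** For a finite lower
set of cells `μ ⊆ ℕ × ℕ` (a Young diagram, cells `(row, col)`, content `col − row`, sign
`π = (-1)^{row+col}`) and every `u : ℤ`, the alternating corner charge left of `u`,
`Σ_{addable B, content B < u} π(B) − Σ_{removable B, content B < u} π(B)`, equals
`[0 < u] − Σ_{x ∈ μ} κ(u − content x) π(x)` with `κ(d) = 4 (d ≥ 2), 3 (d = 1), 1 (d = 0),
0 (d < 0)`: each added cell shifts the charge at the contents `content x − 1, content x,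
content x + 1` by `−π(x), −2π(x), −π(x)` (`altCharge_insert`); induction on `#μ`. This is
the `p = 2` mechanism behind the Brundan–Kleshchev–Wang tableau degree. [folklore] -/
theorem altCornerCharge_eq : ∀ (μ : Finset (ℕ × ℕ)), (∀ x ∈ μ, ∀ y : ℕ × ℕ, y ≤ x → y ∈ μ) → ∀ (u : ℤ), ((Literature.RepresentationTheory.FiniteGroups.addableNodes μ).filter (fun B => (B.2 : ℤ) - B.1 < u)).sum (fun B => (-1 : ℤ) ^ (B.1 + B.2)) - ((Literature.RepresentationTheory.FiniteGroups.removableNodes μ).filter (fun B => (B.2 : ℤ) - B.1 < u)).sum (fun B => (-1 : ℤ) ^ (B.1 + B.2)) = (if 0 < u then 1 else 0) - μ.sum (fun x => (if 2 ≤ u - ((x.2 : ℤ) - x.1) then 4 else if u - ((x.2 : ℤ) - x.1) = 1 then 3 else if u - ((x.2 : ℤ) - x.1) = 0 then 1 else 0) * (-1 : ℤ) ^ (x.1 + x.2)) :=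
  fun μ hμ u => altCharge_eq_of_card μ.card μ rfl hμ u

end Summit.MatrixMultiplication.MatrixMultiplication.Theorems
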